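import Literature.MathematicalPhysics.QuantumManyBody.StateRelaxationKKT
import Literature.MathematicalPhysics.QuantumLattice.GibbsStationaritySlack
import Literature.MathematicalPhysics.QuantumLattice.GroundStateDensityMatrixSupport
import HarnessLib

/-!
# One-point (observable) certificate rows for ground-state relaxations

Topic `Literature/MathematicalPhysics/QuantumManyBody`; namespace
`Literature.MathematicalPhysics.QuantumManyBody.StateRelaxation` (continuation of
`StateRelaxationDuality` / `StateRelaxationKKT`). Everything here is PROVED; no definition and no
named fact is introduced.

`StateRelaxationDuality.le_re_map_of_certificate[_residual]` is weak duality for an ARBITRARY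
objective `h`: an identity `h − c·1 = Σᵢⱼ Λᵢⱼ Pᵢ⋆Pⱼ + n + r` with `Λ ⪰ 0`, `ω(n) = 0`, `−ε ≤ Re ω(r)`
gives `c − ε ≤ Re ω(h)` in every positive normalised `ω`. The tree's certificate ROWS
(`groundEnergy_ge_of_certificate`, `eigenvalue_ge_of_certificate`, and Summits-side
`groundEnergy_ge_of_certificate_kkt_dcomm`) specialise the objective to the Hamiltonian itself,
`h = A`, `ω(A) = E₀`. This file is the ONE-POINT analogue — the objective is an observable `O`, the
state is a ground state of `A`, and the bound is on `Re ω(O)` (Wang–Surace–Frérot–Legat–Renou–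
Magron–Acín 2024 §III: "certifiable bounds on the value of any observable in the ground state";
with the state-optimality rows of Araújo et al. 2023 Prop. 11 / Fawzi–Fawzi–Scalet 2024 §2 such
bounds need no energy window, Wang et al. §VI; Scheer–Chadha–Lu–Khalaf 2025 eq. (2):
`⟨R⟩_min/max` under `tr(O†[H,O]ρ) ≥ 0`):

  `O − v·1 = gramForm Λ P + (Σₖ (A Xₖ − Xₖ A) + Σₗ (Uₗ Yₗ Uₗᴴ − Yₗ)) + (kktForm A G B [+ window] + r)`

with `Λ, G ⪰ 0` certifies `v − ε ≤ Re ω(O)` — and `v·1 − O = …` certifies `Re ω(O) ≤ v + ε` — in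

* the TRACIAL ground state `ω₀ = Matrix.groundStateFunctional A` of any Hermitian `A`, for ANY
  generators `B` and unitaries `Uₗ` commuting with `A` (`re_groundStateFunctional_ge_of_certificate_kkt`,
  `…_exact`, `…_window`, `re_groundStateFunctional_le_of_certificate_kkt`): the rows are
  positivity `ω₀(a⋆a) ≥ 0`, normalisation, the first-order stationarity rows `ω₀(A X − X A) = 0`
  (`GibbsStationaritySlack.groundStateFunctional_comm_eq_zero`), the symmetry rows
  `ω₀(U Y Uᴴ) = ω₀(Y)` (`groundStateFunctional_conj_of_commute`), the second-order ("KKT",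
  state-optimality) rows `0 ≤ ω₀(Cᴴ (A C − C A))` for EVERY matrix `C`
  (`GibbsStationaritySlack.groundStateFunctional_conjTranspose_comm_mul_nonneg`, packaged as
  `groundStateFunctional_kktForm_nonneg`), and optionally the ENERGY-WINDOW rows
  `κ₊ (Ē·1 − A) + κ₋ (A − E̲·1)`, `κ± ≥ 0`, fed by certified `E̲ ≤ E₀(A) ≤ Ē` (Wang et al. §III
  eq. (`o_min`); `re_groundStateFunctional_window_nonneg`);
* EVERY ground-supported density matrix `ρ ⪰ 0`, `tr ρ = 1`, `Aρ = E₀ρ` (equivalently every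
  ground-state density matrix, `isGroundStateDensityMatrix_iff`) that is invariant under the
  unitaries used in the symmetry rows, `Uₗ ρ = ρ Uₗ` (`re_trace_mul_ge_of_certificate_kkt`,
  `…_of_isGroundStateDensityMatrix`): the rows are
  `GibbsStationaritySlack.trace_mul_comm_eq_zero_of_hamiltonian_mul_eq_smul` and
  `trace_mul_conjTranspose_comm_mul_nonneg` — "every ground state, pure or mixed".

The abstract step is `le_re_map_of_certificate_rows`: any ROW ELEMENT `k` with `0 ≤ Re ω(k)` may be
added to the residual. No sector / charge restriction on the generators `B` appears: the state is a
ground state on the WHOLE space (for a particle-number–conserving `A` use `A − μN`, cf.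
`StateRelaxationKKTCharged`; for a Hamiltonian with a symmetry-breaking source there is no conserved
charge and every word — neutral, charged or odd — is an admissible generator). A CONSTRAINT that is
not a row of this shape (e.g. a prescribed filling `ω(N) = n|Λ|` for a Hamiltonian that does not
conserve `N`) is NOT covered: it is not satisfied by the ground state whose observable is bounded.

Deliberately NOT here: the double-commutator block `dcommForm` (Summits-side,
`HubbardLadder/DoubleCommutatorBlocks`: it is `kktForm A G B + kktForm A Gᵀ B⋆ −` a commutator, so
it adds no soundness content), thermodynamic-limit states, and any certificate (these are soundness
edges for certificates produced and checked elsewhere). Instantiation for the pair-sourced Hubbard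
torus (`v − ε ≤ 2L²·dWaveSourceDensity`) is in `QuantumLattice/DWaveSourceOnePointCertificate`.

## References
* J. Wang, J. Surace, I. Frérot, B. Legat, M.-O. Renou, V. Magron, A. Acín, *Certifying ground-state
  properties of many-body systems*, Phys. Rev. X 14 (2024) 031006, §III (observable bounds under an
  energy window), §VI (optimality constraints `⟨[H,O]⟩ = 0`). [cite: WangEtAl2024, §III]
* M. Araújo, I. Klep, A. J. P. Garner, T. Vértesi, M. Navascués, arXiv:2311.18707, §3.2 Prop. 11
  (state optimality). [cite: AraujoEtAl2023, §3.2 Prop. 11]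
* H. Fawzi, O. Fawzi, S. O. Scalet, Nat. Commun. 15 (2024) 7394, §2. [cite: FawziFawziScalet2024, §2]
* M. G. Scheer, N. Chadha, D.-C. Lu, E. Khalaf, arXiv:2511.20860, §II eq. (2)
  (`⟨R⟩_min ≤ tr(Rρ) ≤ ⟨R⟩_max` over ground-state density operators). [cite: ScheerEtAl2025, §II eq. (2)]
* O. Bratteli, D. W. Robinson, *Operator Algebras and Quantum Statistical Mechanics 2* (1997),
  Prop. 5.3.19. [cite: BratteliRobinsonII1997, Prop. 5.3.19]
* I. Kull, N. Schuch, B. Dive, M. Navascués, Phys. Rev. X 14 (2024) 021008, §5.3 (rounded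
  certificates with a residual). [cite: KullEtAl2024, §5.3]
-/

noncomputable section

open Matrix Finset
open scoped ComplexOrder MatrixOrder BigOperators

namespace Literature.MathematicalPhysics.QuantumManyBody.StateRelaxation

/-! ### Abstract `⋆`-algebra: weak duality with row elements -/

section Abstract

variable {𝓐 : Type*} [Ring 𝓐] [StarRing 𝓐] [Algebra ℂ 𝓐] [StarModule ℂ 𝓐]
variable {m : Type*} [Fintype m] [DecidableEq m]

/-- **One-point weak duality with row elements.** For a positive normalised functional `ω`, an
identity `O − v·1 = Σᵢⱼ Λᵢⱼ Pᵢ⋆Pⱼ + n + (k + r)` with `Λ ⪰ 0`, a NULL element `ω(n) = 0`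
(first-order / symmetry rows), a ROW element `0 ≤ Re ω(k)` (state-optimality blocks, energy-window
rows, …) and a residual `−ε ≤ Re ω(r)` certifies `v − ε ≤ Re ω(O)` — Wang et al. 2024 §III
eq. (`o_min`) read through the dual, with KSDN's residual. [cite: WangEtAl2024, §III]
[cite: KullEtAl2024, §5.3] -/
theorem le_re_map_of_certificate_rows (ω : 𝓐 →ₗ[ℂ] ℂ) (hpos : ∀ a, 0 ≤ ω (star a * a))
    (hone : ω 1 = 1) {Λ : Matrix m m ℂ} (hΛ : Λ.PosSemidef) (P : m → 𝓐) {O n k r : 𝓐}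
    (hn : ω n = 0) (hk : 0 ≤ (ω k).re) {ε : ℝ} (hr : -ε ≤ (ω r).re) {v : ℝ}
    (hcert : O - (v : ℂ) • (1 : 𝓐) = gramForm Λ P + n + (k + r)) : v - ε ≤ (ω O).re := by
  have hkr : -ε ≤ (ω (k + r)).re := by
    rw [map_add, Complex.add_re]
    linarith
  exact le_re_map_of_certificate_residual ω hpos hone hΛ P hn hkr hcert

/-- Exact form (`r = 0`): `O − v·1 = Σᵢⱼ Λᵢⱼ Pᵢ⋆Pⱼ + n + k` certifies `v ≤ Re ω(O)`.
[cite: WangEtAl2024, §III] -/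
theorem le_re_map_of_certificate_rows_exact (ω : 𝓐 →ₗ[ℂ] ℂ) (hpos : ∀ a, 0 ≤ ω (star a * a))
    (hone : ω 1 = 1) {Λ : Matrix m m ℂ} (hΛ : Λ.PosSemidef) (P : m → 𝓐) {O n k : 𝓐}
    (hn : ω n = 0) (hk : 0 ≤ (ω k).re) {v : ℝ}
    (hcert : O - (v : ℂ) • (1 : 𝓐) = gramForm Λ P + n + k) : v ≤ (ω O).re := by
  have hcert' : O - (v : ℂ) • (1 : 𝓐) = gramForm Λ P + n + (k + 0) := by rw [hcert, add_zero]
  have h := le_re_map_of_certificate_rows ω hpos hone hΛ P hn hk (r := 0) (ε := 0)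
    (by rw [map_zero, Complex.zero_re, neg_zero]) hcert'
  linarith

/-- **Upper edge** (`⟨O⟩_max`): `v·1 − O = Σᵢⱼ Λᵢⱼ Pᵢ⋆Pⱼ + n + (k + r)` with the same rows
certifies `Re ω(O) ≤ v + ε` (the lower edge for `−O`). [cite: WangEtAl2024, §III]
[cite: ScheerEtAl2025, §II eq. (2)] -/
theorem re_map_le_of_certificate_rows (ω : 𝓐 →ₗ[ℂ] ℂ) (hpos : ∀ a, 0 ≤ ω (star a * a))
    (hone : ω 1 = 1) {Λ : Matrix m m ℂ} (hΛ : Λ.PosSemidef) (P : m → 𝓐) {O n k r : 𝓐}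
    (hn : ω n = 0) (hk : 0 ≤ (ω k).re) {ε : ℝ} (hr : -ε ≤ (ω r).re) {v : ℝ}
    (hcert : (v : ℂ) • (1 : 𝓐) - O = gramForm Λ P + n + (k + r)) : (ω O).re ≤ v + ε := by
  have hcert' : (-O) - ((-v : ℝ) : ℂ) • (1 : 𝓐) = gramForm Λ P + n + (k + r) := by
    rw [Complex.ofReal_neg, neg_smul, sub_neg_eq_add, neg_add_eq_sub, hcert]
  have h := le_re_map_of_certificate_rows ω hpos hone hΛ P hn hk hr hcert'
  rw [map_neg, Complex.neg_re] at h
  linarith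

end Abstract

/-! ### The tracial ground state of a Hermitian matrix: rows and certificate edges -/

section Tracial

open Literature.MathematicalPhysics.QuantumLattice

variable {n : Type*} [Fintype n] [DecidableEq n]
variable {m : Type*} [Fintype m] [DecidableEq m]
variable {p : Type*} [Fintype p] [DecidableEq p]

/-- **KKT block in the tracial ground state, any generators** (nonnegative complex number): for
Hermitian `A` and `G ⪰ 0`, `0 ≤ ω₀(kktForm A G B)` — every one-generator row
`0 ≤ ω₀(Cᴴ (A C − C A))` holds (`groundStateFunctional_conjTranspose_comm_mul_nonneg`) and the
block is their `G`-weighted sum (`map_kktForm_nonneg`). [cite: AraujoEtAl2023, §3.2 Prop. 11]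
[cite: BratteliRobinsonII1997, Prop. 5.3.19] -/
theorem groundStateFunctional_kktForm_nonneg {A : Matrix n n ℂ} (hA : A.IsHermitian)
    {G : Matrix p p ℂ} (hG : G.PosSemidef) (B : p → Matrix n n ℂ) :
    0 ≤ A.groundStateFunctional (kktForm A G B) :=
  map_kktForm_nonneg _ A hG B fun w => by
    rw [Matrix.star_eq_conjTranspose]
    exact groundStateFunctional_conjTranspose_comm_mul_nonneg hA _

/-- **Null rows in the tracial ground state**: commutators with `A` (first-order stationarity,
Han 2020 / Wang et al. §VI `⟨[H,O]⟩ = 0`) and symmetry defects `U Y Uᴴ − Y` for unitaries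
commuting with `A` have zero expectation. [cite: WangEtAl2024, §VI] -/
theorem groundStateFunctional_nullRows_eq_zero {A : Matrix n n ℂ} (hA : A.IsHermitian)
    {ι₁ : Type*} (s : Finset ι₁) (X : ι₁ → Matrix n n ℂ)
    {ι₂ : Type*} (t : Finset ι₂) (U Y : ι₂ → Matrix n n ℂ)
    (hU : ∀ l ∈ t, U l * A = A * U l) (hUU : ∀ l ∈ t, (U l)ᴴ * U l = 1) :
    A.groundStateFunctional
        (∑ b ∈ s, (A * X b - X b * A) + ∑ l ∈ t, (U l * Y l * (U l)ᴴ - Y l)) = 0 := by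
  rw [map_add, map_sum, map_sum]
  have h1 : ∀ b ∈ s, A.groundStateFunctional (A * X b - X b * A) = 0 := fun b _ =>
    groundStateFunctional_comm_eq_zero hA (X b)
  have h2 : ∀ l ∈ t, A.groundStateFunctional (U l * Y l * (U l)ᴴ - Y l) = 0 := fun l hl => by
    rw [map_sub, groundStateFunctional_conj_of_commute hA (hU l hl) (hUU l hl), sub_self]
  rw [Finset.sum_eq_zero h1, Finset.sum_eq_zero h2, add_zero]

/-- **Energy-window rows in the tracial ground state**: certified bounds `E̲ ≤ E₀(A) ≤ Ē` make
`κ₊ (Ē·1 − A) + κ₋ (A − E̲·1)`, `κ± ≥ 0`, a row element: `0 ≤ Re ω₀(·)` (`ω₀(A) = E₀(A)`).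
Wang et al. 2024 §III (the constraints `⟨E_var − H⟩ ≥ 0`, `⟨H − E_SDP⟩ ≥ 0` of eq. (`o_min`)).
[cite: WangEtAl2024, §III] -/
theorem re_groundStateFunctional_window_nonneg [Nonempty n] {A : Matrix n n ℂ} (hA : A.IsHermitian)
    {κup κlo Eup Elo : ℝ} (hκup : 0 ≤ κup) (hκlo : 0 ≤ κlo) (hup : A.groundEnergy ≤ Eup)
    (hlo : Elo ≤ A.groundEnergy) :
    0 ≤ (A.groundStateFunctional ((κup : ℂ) • ((Eup : ℂ) • (1 : Matrix n n ℂ) - A) +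
      (κlo : ℂ) • (A - (Elo : ℂ) • (1 : Matrix n n ℂ)))).re := by
  have hval : A.groundStateFunctional ((κup : ℂ) • ((Eup : ℂ) • (1 : Matrix n n ℂ) - A) +
      (κlo : ℂ) • (A - (Elo : ℂ) • (1 : Matrix n n ℂ))) =
        ((κup * (Eup - A.groundEnergy) + κlo * (A.groundEnergy - Elo) : ℝ) : ℂ) := by
    rw [map_add, map_smul, map_smul, map_sub, map_sub, map_smul, map_smul,
      groundStateFunctional_one hA, groundStateFunctional_hamiltonian hA]
    simp only [smul_eq_mul, mul_one]
    push_cast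
    ring
  rw [hval, Complex.ofReal_re]
  exact add_nonneg (mul_nonneg hκup (sub_nonneg.2 hup)) (mul_nonneg hκlo (sub_nonneg.2 hlo))

/-- **One-point certificate row, tracial ground state** (the one-point analogue of
`groundEnergy_ge_of_certificate_kkt_dcomm`): for ANY Hermitian `A` on a nonempty index type, an
identity
`O − v·1 = Σ Λᵢⱼ Pᵢᴴ Pⱼ + (Σₖ (A Xₖ − Xₖ A) + Σₗ (Uₗ Yₗ Uₗᴴ − Yₗ)) + (kktForm A G B + r)`
with `Λ, G ⪰ 0`, unitaries `Uₗ` commuting with `A`, arbitrary generators `B` (no charge or sector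
restriction) and a residual with `−ε ≤ Re ω₀(r)` certifies `v − ε ≤ Re ω₀(O)` for the tracial
ground-state functional `ω₀ = A.groundStateFunctional`. Several KKT blocks are one block with a
block-diagonal multiplier (`kktForm_add`). [cite: WangEtAl2024, §III, §VI]
[cite: AraujoEtAl2023, §3.2 Prop. 11] [cite: KullEtAl2024, §5.3] -/
theorem re_groundStateFunctional_ge_of_certificate_kkt [Nonempty n] {A : Matrix n n ℂ}
    (hA : A.IsHermitian) {Λ : Matrix m m ℂ} (hΛ : Λ.PosSemidef) (P : m → Matrix n n ℂ)
    {ι₁ : Type*} (s : Finset ι₁) (X : ι₁ → Matrix n n ℂ)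
    {ι₂ : Type*} (t : Finset ι₂) (U Y : ι₂ → Matrix n n ℂ)
    (hU : ∀ l ∈ t, U l * A = A * U l) (hUU : ∀ l ∈ t, (U l)ᴴ * U l = 1)
    {G : Matrix p p ℂ} (hG : G.PosSemidef) (B : p → Matrix n n ℂ)
    {r : Matrix n n ℂ} {ε : ℝ} (hr : -ε ≤ (A.groundStateFunctional r).re)
    {O : Matrix n n ℂ} {v : ℝ}
    (hcert : O - (v : ℂ) • (1 : Matrix n n ℂ) =
      gramForm Λ P + (∑ b ∈ s, (A * X b - X b * A) + ∑ l ∈ t, (U l * Y l * (U l)ᴴ - Y l)) +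
        (kktForm A G B + r)) :
    v - ε ≤ (A.groundStateFunctional O).re :=
  le_re_map_of_certificate_rows A.groundStateFunctional
    (fun a => by rw [Matrix.star_eq_conjTranspose]; exact groundStateFunctional_nonneg A a)
    (groundStateFunctional_one hA) hΛ P (groundStateFunctional_nullRows_eq_zero hA s X t U Y hU hUU)
    (Complex.nonneg_iff.mp (groundStateFunctional_kktForm_nonneg hA hG B)).1 hr hcert

/-- **Exact form** (`r = 0`): `v ≤ Re ω₀(O)`. [cite: WangEtAl2024, §III, §VI]
[cite: AraujoEtAl2023, §3.2 Prop. 11] -/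
theorem re_groundStateFunctional_ge_of_certificate_kkt_exact [Nonempty n] {A : Matrix n n ℂ}
    (hA : A.IsHermitian) {Λ : Matrix m m ℂ} (hΛ : Λ.PosSemidef) (P : m → Matrix n n ℂ)
    {ι₁ : Type*} (s : Finset ι₁) (X : ι₁ → Matrix n n ℂ)
    {ι₂ : Type*} (t : Finset ι₂) (U Y : ι₂ → Matrix n n ℂ)
    (hU : ∀ l ∈ t, U l * A = A * U l) (hUU : ∀ l ∈ t, (U l)ᴴ * U l = 1)
    {G : Matrix p p ℂ} (hG : G.PosSemidef) (B : p → Matrix n n ℂ)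
    {O : Matrix n n ℂ} {v : ℝ}
    (hcert : O - (v : ℂ) • (1 : Matrix n n ℂ) =
      gramForm Λ P + (∑ b ∈ s, (A * X b - X b * A) + ∑ l ∈ t, (U l * Y l * (U l)ᴴ - Y l)) +
        kktForm A G B) :
    v ≤ (A.groundStateFunctional O).re :=
  le_re_map_of_certificate_rows_exact A.groundStateFunctional
    (fun a => by rw [Matrix.star_eq_conjTranspose]; exact groundStateFunctional_nonneg A a)
    (groundStateFunctional_one hA) hΛ P (groundStateFunctional_nullRows_eq_zero hA s X t U Y hU hUU)
    (Complex.nonneg_iff.mp (groundStateFunctional_kktForm_nonneg hA hG B)).1 hcert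

/-- **One-point certificate row with an energy window**: as
`re_groundStateFunctional_ge_of_certificate_kkt`, with the additional row element
`κ₊ (Ē·1 − A) + κ₋ (A − E̲·1)` fed by certified `E̲ ≤ E₀(A) ≤ Ē`, `κ± ≥ 0` (Wang et al. 2024 §III
eq. (`o_min`): the observable bound assisted by a variational upper and a relaxation lower bound on
the energy). [cite: WangEtAl2024, §III] [cite: AraujoEtAl2023, §3.2 Prop. 11] -/
theorem re_groundStateFunctional_ge_of_certificate_kkt_window [Nonempty n] {A : Matrix n n ℂ}
    (hA : A.IsHermitian) {Λ : Matrix m m ℂ} (hΛ : Λ.PosSemidef) (P : m → Matrix n n ℂ)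
    {ι₁ : Type*} (s : Finset ι₁) (X : ι₁ → Matrix n n ℂ)
    {ι₂ : Type*} (t : Finset ι₂) (U Y : ι₂ → Matrix n n ℂ)
    (hU : ∀ l ∈ t, U l * A = A * U l) (hUU : ∀ l ∈ t, (U l)ᴴ * U l = 1)
    {G : Matrix p p ℂ} (hG : G.PosSemidef) (B : p → Matrix n n ℂ)
    {κup κlo Eup Elo : ℝ} (hκup : 0 ≤ κup) (hκlo : 0 ≤ κlo) (hup : A.groundEnergy ≤ Eup)
    (hlo : Elo ≤ A.groundEnergy)
    {r : Matrix n n ℂ} {ε : ℝ} (hr : -ε ≤ (A.groundStateFunctional r).re)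
    {O : Matrix n n ℂ} {v : ℝ}
    (hcert : O - (v : ℂ) • (1 : Matrix n n ℂ) =
      gramForm Λ P + (∑ b ∈ s, (A * X b - X b * A) + ∑ l ∈ t, (U l * Y l * (U l)ᴴ - Y l)) +
        (kktForm A G B + ((κup : ℂ) • ((Eup : ℂ) • (1 : Matrix n n ℂ) - A) +
          (κlo : ℂ) • (A - (Elo : ℂ) • (1 : Matrix n n ℂ))) + r)) :
    v - ε ≤ (A.groundStateFunctional O).re := by
  have hk : 0 ≤ (A.groundStateFunctional (kktForm A G B +
      ((κup : ℂ) • ((Eup : ℂ) • (1 : Matrix n n ℂ) - A) +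
        (κlo : ℂ) • (A - (Elo : ℂ) • (1 : Matrix n n ℂ))))).re := by
    rw [map_add, Complex.add_re]
    exact add_nonneg (Complex.nonneg_iff.mp (groundStateFunctional_kktForm_nonneg hA hG B)).1
      (re_groundStateFunctional_window_nonneg hA hκup hκlo hup hlo)
  exact le_re_map_of_certificate_rows A.groundStateFunctional
    (fun a => by rw [Matrix.star_eq_conjTranspose]; exact groundStateFunctional_nonneg A a)
    (groundStateFunctional_one hA) hΛ P (groundStateFunctional_nullRows_eq_zero hA s X t U Y hU hUU)
    hk hr hcert

/-- **Upper edge, tracial ground state** (`⟨O⟩_max`): `v·1 − O = …` with the same rows certifies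
`Re ω₀(O) ≤ v + ε`. [cite: WangEtAl2024, §III] [cite: ScheerEtAl2025, §II eq. (2)] -/
theorem re_groundStateFunctional_le_of_certificate_kkt [Nonempty n] {A : Matrix n n ℂ}
    (hA : A.IsHermitian) {Λ : Matrix m m ℂ} (hΛ : Λ.PosSemidef) (P : m → Matrix n n ℂ)
    {ι₁ : Type*} (s : Finset ι₁) (X : ι₁ → Matrix n n ℂ)
    {ι₂ : Type*} (t : Finset ι₂) (U Y : ι₂ → Matrix n n ℂ)
    (hU : ∀ l ∈ t, U l * A = A * U l) (hUU : ∀ l ∈ t, (U l)ᴴ * U l = 1)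
    {G : Matrix p p ℂ} (hG : G.PosSemidef) (B : p → Matrix n n ℂ)
    {r : Matrix n n ℂ} {ε : ℝ} (hr : -ε ≤ (A.groundStateFunctional r).re)
    {O : Matrix n n ℂ} {v : ℝ}
    (hcert : (v : ℂ) • (1 : Matrix n n ℂ) - O =
      gramForm Λ P + (∑ b ∈ s, (A * X b - X b * A) + ∑ l ∈ t, (U l * Y l * (U l)ᴴ - Y l)) +
        (kktForm A G B + r)) :
    (A.groundStateFunctional O).re ≤ v + ε :=
  re_map_le_of_certificate_rows A.groundStateFunctional
    (fun a => by rw [Matrix.star_eq_conjTranspose]; exact groundStateFunctional_nonneg A a)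
    (groundStateFunctional_one hA) hΛ P (groundStateFunctional_nullRows_eq_zero hA s X t U Y hU hUU)
    (Complex.nonneg_iff.mp (groundStateFunctional_kktForm_nonneg hA hG B)).1 hr hcert

end Tracial

/-! ### Every (symmetric) ground-supported density matrix -/

section DensityMatrix

open Literature.MathematicalPhysics.QuantumLattice
open Literature.Barriers.HubbardSuperconductivity (IsGroundStateDensityMatrix)

variable {n : Type*} [Fintype n] [DecidableEq n]
variable {m : Type*} [Fintype m] [DecidableEq m]
variable {p : Type*} [Fintype p] [DecidableEq p]

/-- Positivity row of a density matrix: `0 ≤ tr(ρ Xᴴ X)` for `ρ ⪰ 0` (`ρ = Sᴴ S`,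
`tr(Sᴴ S Xᴴ X) = tr(S Xᴴ X Sᴴ) ≥ 0`). [folklore] -/
private theorem trace_mul_conjTranspose_mul_nonneg_of_posSemidef {ρ : Matrix n n ℂ} (hρ : ρ.PosSemidef)
    (X : Matrix n n ℂ) : 0 ≤ (ρ * (Xᴴ * X)).trace := by
  obtain ⟨S, hS⟩ := CStarAlgebra.nonneg_iff_eq_star_mul_self.mp hρ.nonneg
  rw [hS, Matrix.star_eq_conjTranspose, Matrix.mul_assoc, trace_mul_comm]
  exact ((posSemidef_conjTranspose_mul_self X).mul_mul_conjTranspose_same S).trace_nonneg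

/-- Symmetry row of an invariant state: `tr(ρ (U Y Uᴴ − Y)) = 0` when `Uᴴ U = 1` and `U ρ = ρ U`.
[folklore] -/
private theorem trace_mul_conj_sub_eq_zero_of_commute {ρ U : Matrix n n ℂ} (hUU : Uᴴ * U = 1)
    (hUρ : U * ρ = ρ * U) (Y : Matrix n n ℂ) : (ρ * (U * Y * Uᴴ - Y)).trace = 0 := by
  have h : (ρ * (U * Y * Uᴴ)).trace = (ρ * Y).trace := by
    calc (ρ * (U * Y * Uᴴ)).trace = (Uᴴ * ρ * U * Y).trace := by
          rw [← Matrix.mul_assoc, trace_mul_comm, ← Matrix.mul_assoc, ← Matrix.mul_assoc]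
      _ = (ρ * Y).trace := by
          rw [Matrix.mul_assoc Uᴴ ρ U, ← hUρ, ← Matrix.mul_assoc, hUU, Matrix.one_mul]
  rw [Matrix.mul_sub, trace_sub, h, sub_self]

/-- **One-point certificate row, every symmetric ground-supported density matrix.** For Hermitian
`A`, a state `ρ ⪰ 0`, `tr ρ = 1` supported on the ground space (`Aρ = E₀ρ`) and commuting with the
unitaries of the symmetry rows (`Uₗ ρ = ρ Uₗ`, `Uₗᴴ Uₗ = 1`): an identity
`O − v·1 = Σ Λᵢⱼ Pᵢᴴ Pⱼ + (Σₖ (A Xₖ − Xₖ A) + Σₗ (Uₗ Yₗ Uₗᴴ − Yₗ)) + (kktForm A G B + r)` with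
`Λ, G ⪰ 0`, arbitrary generators `B` and `−ε ≤ Re tr(ρ r)` certifies `v − ε ≤ Re tr(ρ O)`. The rows
hold because `tr(ρ(A X − X A)) = 0` and `0 ≤ tr(ρ Cᴴ(A C − C A))` in every such state
(`GibbsStationaritySlack` §GroundStateMixed). With `t = ∅` this is "every ground state, pure or
mixed". [cite: ScheerEtAl2025, §II eq. (2)] [cite: AraujoEtAl2023, §3.2 Prop. 11]
[cite: BratteliRobinsonII1997, Prop. 5.3.19] -/
theorem re_trace_mul_ge_of_certificate_kkt {A ρ : Matrix n n ℂ} (hA : A.IsHermitian)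
    (hρ : ρ.PosSemidef) (hρ1 : ρ.trace = 1) (hAρ : A * ρ = (A.groundEnergy : ℂ) • ρ)
    {Λ : Matrix m m ℂ} (hΛ : Λ.PosSemidef) (P : m → Matrix n n ℂ)
    {ι₁ : Type*} (s : Finset ι₁) (X : ι₁ → Matrix n n ℂ)
    {ι₂ : Type*} (t : Finset ι₂) (U Y : ι₂ → Matrix n n ℂ)
    (hUU : ∀ l ∈ t, (U l)ᴴ * U l = 1) (hUρ : ∀ l ∈ t, U l * ρ = ρ * U l)
    {G : Matrix p p ℂ} (hG : G.PosSemidef) (B : p → Matrix n n ℂ)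
    {r : Matrix n n ℂ} {ε : ℝ} (hr : -ε ≤ (ρ * r).trace.re) {O : Matrix n n ℂ} {v : ℝ}
    (hcert : O - (v : ℂ) • (1 : Matrix n n ℂ) =
      gramForm Λ P + (∑ b ∈ s, (A * X b - X b * A) + ∑ l ∈ t, (U l * Y l * (U l)ᴴ - Y l)) +
        (kktForm A G B + r)) :
    v - ε ≤ (ρ * O).trace.re := by
  let ω : Matrix n n ℂ →ₗ[ℂ] ℂ := Matrix.traceLinearMap n ℂ ℂ ∘ₗ LinearMap.mulLeft ℂ ρ
  have hω : ∀ Z : Matrix n n ℂ, ω Z = (ρ * Z).trace := fun Z => rfl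
  have hpos : ∀ a : Matrix n n ℂ, 0 ≤ ω (star a * a) := fun a => by
    rw [hω, Matrix.star_eq_conjTranspose]
    exact trace_mul_conjTranspose_mul_nonneg_of_posSemidef hρ a
  have hone : ω 1 = 1 := by rw [hω, Matrix.mul_one, hρ1]
  have hnull : ω (∑ b ∈ s, (A * X b - X b * A) + ∑ l ∈ t, (U l * Y l * (U l)ᴴ - Y l)) = 0 := by
    rw [map_add, map_sum, map_sum]
    have h1 : ∀ b ∈ s, ω (A * X b - X b * A) = 0 := fun b _ => by
      rw [hω]
      exact trace_mul_comm_eq_zero_of_hamiltonian_mul_eq_smul hA hρ.1 hAρ (X b)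
    have h2 : ∀ l ∈ t, ω (U l * Y l * (U l)ᴴ - Y l) = 0 := fun l hl => by
      rw [hω]
      exact trace_mul_conj_sub_eq_zero_of_commute (hUU l hl) (hUρ l hl) (Y l)
    rw [Finset.sum_eq_zero h1, Finset.sum_eq_zero h2, add_zero]
  have hk : 0 ≤ (ω (kktForm A G B)).re := by
    refine (Complex.nonneg_iff.mp (map_kktForm_nonneg ω A hG B fun w => ?_)).1
    rw [hω, Matrix.star_eq_conjTranspose]
    exact trace_mul_conjTranspose_comm_mul_nonneg hA hρ hAρ _
  have hr' : -ε ≤ (ω r).re := by rw [hω]; exact hr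
  have h := le_re_map_of_certificate_rows ω hpos hone hΛ P hnull hk hr' hcert
  rwa [hω] at h

/-- The same for a GROUND-STATE DENSITY MATRIX in the summit's certificate vocabulary
(`IsGroundStateDensityMatrix A ρ`: a density matrix minimising `Re tr(ρA)`; it is ground-supported
by `hamiltonian_mul_eq_smul_of_isGroundStateDensityMatrix`). [cite: ScheerEtAl2025, §II eq. (2)]
[cite: AraujoEtAl2023, §3.2 Prop. 11] -/
theorem re_trace_mul_ge_of_certificate_kkt_of_isGroundStateDensityMatrix [Nonempty n]
    {A ρ : Matrix n n ℂ} (hA : A.IsHermitian) (hρ : IsGroundStateDensityMatrix A ρ)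
    {Λ : Matrix m m ℂ} (hΛ : Λ.PosSemidef) (P : m → Matrix n n ℂ)
    {ι₁ : Type*} (s : Finset ι₁) (X : ι₁ → Matrix n n ℂ)
    {ι₂ : Type*} (t : Finset ι₂) (U Y : ι₂ → Matrix n n ℂ)
    (hUU : ∀ l ∈ t, (U l)ᴴ * U l = 1) (hUρ : ∀ l ∈ t, U l * ρ = ρ * U l)
    {G : Matrix p p ℂ} (hG : G.PosSemidef) (B : p → Matrix n n ℂ)
    {r : Matrix n n ℂ} {ε : ℝ} (hr : -ε ≤ (ρ * r).trace.re) {O : Matrix n n ℂ} {v : ℝ}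
    (hcert : O - (v : ℂ) • (1 : Matrix n n ℂ) =
      gramForm Λ P + (∑ b ∈ s, (A * X b - X b * A) + ∑ l ∈ t, (U l * Y l * (U l)ᴴ - Y l)) +
        (kktForm A G B + r)) :
    v - ε ≤ (ρ * O).trace.re :=
  re_trace_mul_ge_of_certificate_kkt hA hρ.1.1 hρ.1.2
    (hamiltonian_mul_eq_smul_of_isGroundStateDensityMatrix hA hρ) hΛ P s X t U Y hUU hUρ hG B hr
    hcert

end DensityMatrix

end Literature.MathematicalPhysics.QuantumManyBody.StateRelaxation
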